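import Summits.BirchSwinnertonDyer.BirchSwinnertonDyer.Theorems.KimAtThreeDeepLowerOffStratumLevelLoweringMultiStabConditionOne
import HarnessLib

/-!
# Route `SignedLowerHalves`, crux L `SmallImageLowerHalfBothSigns` (item stmt-BirchSwinnertonDyer-23599), line `rtt_w3`,
# stub Kan₂ `stub_thetaLayerLambda_ns` — brick K2a (part 1): the FULL DEPLETION `ι₁G − a_ℓ ι_ℓ G + ℓ ι_{ℓ²} G` of a normalised
# eigenform at a GOOD prime `ℓ` — Hecke data (`q`-expansion, injectivity, `T_p`, `U_ℓ`, eigenvalues)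

Width seat `bsd-line-slh-p3-w3` g11 under LEAD `cruxlead-stmt-BirchSwinnertonDyer-23599` g0 (cell `bsd-ssimc`). ROUTE-INDEPENDENT
helper (`--supports stmt-BirchSwinnertonDyer-23599`); THEOREMS ONLY — no definition, no named fact, no `sorry`; closes nothing;
BSD is not proved by any of this.

WHY. Kan₂ applies Vatsal's congruence to the `S₀`-DEPLETED forms of `f_W` and of its partner at the common level
`∏_{ℓ∈S₀} ℓ^{max(2,v_ℓ)}`; each needs Vatsal's Condition 1. The tree (cell `bsd-addord`, `KimAtThree…{MultiStab,Deplete}ConditionOne`)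
transports Condition 1 through ONE stabilisation `ι₁ − βι_q` off the level (needs `α ≠ β`) and through `ι₁ − a_ℓι_ℓ` at a prime of the
NEWFORM's level; at a GOOD prime `ℓ ∤ N` Kan₂ needs the FULL depletion `D G = ι₁G − a_ℓ(G)ι_ℓG + ℓι_{ℓ²}G ∈ S₂(Γ₀(Nℓ²))` (`U_ℓ D G = 0`).
THIS FILE (part 1): its Hecke data (§1); the companion `…RttKanGoodDepleteConditionOne` proves Condition 1 `G ↦ D G` with NO simple-roots hypothesis: for `V = ker(T_ℓ − a)` at level `N`,
a root `β` of `X² − aX + ℓ`, `E = ι₁ − βι_ℓ`, the old forms of the newform `g` at level `Nℓ²` lie in `D(V) + E(V) + ι_ℓ(V)`; on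
`Y = E(V) + ι_ℓ(V)` the operator `U_ℓ` is stable with `U² − aU + ℓ = 0`, hence injective (`ℓ ≠ 0`), so a generalised `U_ℓ`-null
vector of the old space is `D w₀`; `D` is injective and commutes with `T_p` (`p ≠ ℓ`), and Condition 1 of `G` gives `w₀ ∈ ℂG`.

* §1 `cuspCoeff_goodDeplete`, `isNormalized_goodDeplete`, `eq_zero_of_goodDeplete_eq_zero`, `heckeT_goodDeplete_of_ne`,
  `heckeT_iota_{one,ell,ellSq}_goodLevel`, `heckeT_goodDeplete_self`, `isHeckeEigenform_goodDeplete`, `cuspCoeff_goodDeplete_prime`,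
  `heckeEigenvalue_goodDeplete`.
* (§2, companion file) `hasSimpleHeckeGenEigenspace_goodDeplete_of_hasSimpleHeckeGenEigenspace`.

References: [Vatsal1999] (1.2) Condition 1; [AtkinLehner1970] Thm. 3–5; [DiamondShurman2005] Prop. 5.6.2, §5.7, Thm. 5.8.3;
[GreenbergVatsal2000] §1 (8) (the `Σ₀`-depleted form).
-/

set_option autoImplicit false
-- D-0017: single-problem summit, the namespace repeats the problem name by design.
set_option linter.dupNamespace false

noncomputable section

open scoped MatrixGroups ModularForm Classical NNReal

open CongruenceSubgroup Literature.NumberTheory.EllipticCurves Literature.NumberTheory.EllipticCurves.ModularForms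
open UpperHalfPlane hiding I

namespace Summit.BirchSwinnertonDyer.BirchSwinnertonDyer.Theorems.SmallImageRttKan

open Summit.BirchSwinnertonDyer.BirchSwinnertonDyer.Theorems.KimAtThreeDeepLowerOffStratumLevelLoweringConditionOne
open Summit.BirchSwinnertonDyer.BirchSwinnertonDyer.Theorems.KimAtThreeDeepLowerOffStratumLevelLoweringDoubleStabConditionOne
  (iota_iota)
open Summit.BirchSwinnertonDyer.BirchSwinnertonDyer.Theorems.KimAtThreeDeepLowerOffStratumLevelLoweringMultiStabConditionOne
  (pow_sub_smul_one_apply_comm)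

/-! ### §1 The good-prime depletion `D = ι₁ − a ι_ℓ + ℓ ι_{ℓ²} : S₂(Γ₀(N)) → S₂(Γ₀(Nℓ²))` -/

section Operators

variable {N N' ℓ : ℕ} [NeZero N] [NeZero N'] [NeZero ℓ]
  (h1 : N * 1 ∣ N') (hℓ1 : N * ℓ ∣ N') (hℓ2 : N * (ℓ * ℓ) ∣ N')

omit [NeZero N] [NeZero N'] in
/-- **`q`-expansion of the good-prime depletion**: `aₙ(ι₁w − a ι_ℓ w + ℓ ι_{ℓ²} w) = aₙ(w) − a·𝟙_{ℓ∣n} a_{n/ℓ}(w) + ℓ·𝟙_{ℓ²∣n}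
a_{n/ℓ²}(w)`. [cite: DiamondShurman2005, §5.7 (ι_d on Fourier expansions)] -/
theorem cuspCoeff_goodDeplete (w : CuspForm (Gamma0 N) 2) (a : ℂ) (n : ℕ) :
    cuspCoeff (iota N N' 1 2 h1 w - a • iota N N' ℓ 2 hℓ1 w + (ℓ : ℂ) • iota N N' (ℓ * ℓ) 2 hℓ2 w) n =
      cuspCoeff w n - a * (if ℓ ∣ n then cuspCoeff w (n / ℓ) else 0) +
        (ℓ : ℂ) * (if ℓ * ℓ ∣ n then cuspCoeff w (n / (ℓ * ℓ)) else 0) := by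
  simp only [cuspCoeff, qExpansion_coeff_add_level0, qExpansion_coeff_sub_smul, qExpansion_coeff_smul, qExpansion_coeff_iota,
    one_dvd, if_true, Nat.div_one]

omit [NeZero N] [NeZero N'] in
/-- The good-prime depletion of a normalised form is normalised (`ℓ ∤ 1`). [cite: DiamondShurman2005, §5.7] -/
theorem isNormalized_goodDeplete {w : CuspForm (Gamma0 N) 2} (hw : IsNormalized w) (hℓ : ℓ.Prime) (a : ℂ) :
    IsNormalized (iota N N' 1 2 h1 w - a • iota N N' ℓ 2 hℓ1 w + (ℓ : ℂ) • iota N N' (ℓ * ℓ) 2 hℓ2 w) := by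
  have h := cuspCoeff_goodDeplete h1 hℓ1 hℓ2 w a 1
  have hℓ1' : ¬ ℓ ∣ 1 := hℓ.not_dvd_one
  have hℓℓ1 : ¬ ℓ * ℓ ∣ 1 := fun h' ↦ hℓ1' ((dvd_mul_right ℓ ℓ).trans h')
  rw [if_neg hℓ1', if_neg hℓℓ1, mul_zero, mul_zero, sub_zero, add_zero] at h
  unfold IsNormalized at hw ⊢
  rw [← cuspCoeff] at hw ⊢
  rw [h, hw]

omit [NeZero N] [NeZero N'] in
/-- **The good-prime depletion is injective**: `ι₁w − a ι_ℓ w + ℓ ι_{ℓ²} w = 0 ⟹ w = 0` (strong induction on the `q`-expansion,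
`a₀(w) = 0`). [cite: DiamondShurman2005, §5.7 (ι_d on Fourier expansions)] -/
theorem eq_zero_of_goodDeplete_eq_zero (hℓ : ℓ.Prime) (w : CuspForm (Gamma0 N) 2) (a : ℂ)
    (h : iota N N' 1 2 h1 w - a • iota N N' ℓ 2 hℓ1 w + (ℓ : ℂ) • iota N N' (ℓ * ℓ) 2 hℓ2 w = 0) : w = 0 := by
  have hco : ∀ n : ℕ, cuspCoeff w n = a * (if ℓ ∣ n then cuspCoeff w (n / ℓ) else 0) -
      (ℓ : ℂ) * (if ℓ * ℓ ∣ n then cuspCoeff w (n / (ℓ * ℓ)) else 0) := by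
    intro n
    have e := congrArg (fun φ : CuspForm (Gamma0 N') 2 ↦ cuspCoeff φ n) h
    simp only [cuspCoeff_goodDeplete] at e
    have e0 : cuspCoeff (0 : CuspForm (Gamma0 N') 2) n = 0 := by
      rw [cuspCoeff, CuspForm.coe_zero, UpperHalfPlane.qExpansion_zero, map_zero]
    rw [e0] at e
    linear_combination e
  refine eq_zero_of_qExpansion_coeff_eq_zero_level0 w fun n ↦ ?_
  induction n using Nat.strong_induction_on with
  | _ n ih =>
    rcases Nat.eq_zero_or_pos n with rfl | hn
    · exact CuspFormClass.qExpansion_coeff_zero w one_pos (one_mem_strictPeriods_gamma0 N)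
    · have e := hco n
      rw [cuspCoeff] at e
      rw [e]
      have hℓ1lt : n / ℓ < n := Nat.div_lt_self hn hℓ.one_lt
      have hℓ2lt : n / (ℓ * ℓ) < n := Nat.div_lt_self hn (by nlinarith [hℓ.one_lt])
      by_cases hℓn : ℓ ∣ n
      · rw [if_pos hℓn, cuspCoeff, ih (n / ℓ) hℓ1lt]
        by_cases hℓℓn : ℓ * ℓ ∣ n
        · rw [if_pos hℓℓn, cuspCoeff, ih (n / (ℓ * ℓ)) hℓ2lt]; ring
        · rw [if_neg hℓℓn]; ring
      · have hℓℓn : ¬ ℓ * ℓ ∣ n := fun h' ↦ hℓn ((dvd_mul_right ℓ ℓ).trans h')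
        rw [if_neg hℓn, if_neg hℓℓn]; ring

/-- **`T_p D = D T_p` for a prime `p ≠ ℓ`** (including `p ∣ N`), `N' = Nℓ²`: `T_p ι_d = ι_d T_p` for `p ∤ d`, `d ∈ {1, ℓ, ℓ²}`.
[cite: DiamondShurman2005, Prop. 5.6.2 (proof, first diagram)] -/
theorem heckeT_goodDeplete_of_ne (hN' : N' = N * (ℓ * ℓ)) (hℓ : ℓ.Prime) {p : ℕ} [NeZero p] (hp : p.Prime) (hpℓ : p ≠ ℓ)
    (v : CuspForm (Gamma0 N) 2) (a : ℂ) :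
    heckeT (Gamma0 N') 2 p (iota N N' 1 2 h1 v - a • iota N N' ℓ 2 hℓ1 v + (ℓ : ℂ) • iota N N' (ℓ * ℓ) 2 hℓ2 v) =
      iota N N' 1 2 h1 (heckeT (Gamma0 N) 2 p v) - a • iota N N' ℓ 2 hℓ1 (heckeT (Gamma0 N) 2 p v) +
        (ℓ : ℂ) • iota N N' (ℓ * ℓ) 2 hℓ2 (heckeT (Gamma0 N) 2 p v) := by
  have hpℓ' : ¬ p ∣ ℓ := fun h ↦ hpℓ ((Nat.prime_dvd_prime_iff_eq hp hℓ).mp h)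
  have hpℓℓ : ¬ p ∣ ℓ * ℓ := fun h ↦ by
    rcases (Nat.Prime.dvd_mul hp).mp h with h' | h' <;> exact hpℓ' h'
  have hiff : p ∣ N ↔ p ∣ N' := by
    rw [hN']
    exact ⟨fun h ↦ h.mul_right _, fun h ↦ ((Nat.Prime.dvd_mul hp).mp h).resolve_right hpℓℓ⟩
  rw [map_add, map_sub, map_smul, map_smul, heckeT_iota_of_not_dvd h1 hp hp.not_dvd_one hiff,
    heckeT_iota_of_not_dvd hℓ1 hp hpℓ' hiff, heckeT_iota_of_not_dvd hℓ2 hp hpℓℓ hiff]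

/-- `U_ℓ ι₁ v = ι₁ T_ℓ v − ℓ ι_ℓ v` at level `N' = Nℓ²` (`ℓ ∤ N`). [cite: DiamondShurman2005, Prop. 5.6.2 (proof, second diagram)] -/
theorem heckeT_iota_one_goodLevel (hN' : N' = N * (ℓ * ℓ)) (hℓ : ℓ.Prime) (hℓN : ¬ ℓ ∣ N) (v : CuspForm (Gamma0 N) 2) :
    heckeT (Gamma0 N') 2 ℓ (iota N N' 1 2 h1 v) =
      iota N N' 1 2 h1 (heckeT (Gamma0 N) 2 ℓ v) - (ℓ : ℂ) • iota N N' ℓ 2 hℓ1 v := by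
  have hℓN' : ℓ ∣ N' := by rw [hN']; exact (dvd_mul_right ℓ ℓ).trans (dvd_mul_left _ N)
  have h2 : N * (1 * ℓ) ∣ N' := by rw [one_mul]; exact hℓ1
  rw [heckeT_iota_of_dvd_of_not_dvd h1 h2 hℓ hℓN' hℓN hℓ.not_dvd_one v, iota_congr (one_mul ℓ) h2 hℓ1 v,
    show (2 : ℤ) - 1 = 1 by norm_num, zpow_one]

/-- `U_ℓ ι_ℓ v = ι₁ v` at level `N' = Nℓ²`. [cite: DiamondShurman2005, Prop. 5.6.2 (proof, second diagram)] -/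
theorem heckeT_iota_ell_goodLevel (hN' : N' = N * (ℓ * ℓ)) (hℓ : ℓ.Prime) (v : CuspForm (Gamma0 N) 2) :
    heckeT (Gamma0 N') 2 ℓ (iota N N' ℓ 2 hℓ1 v) = iota N N' 1 2 h1 v := by
  have hℓN' : ℓ ∣ N' := by rw [hN']; exact (dvd_mul_right ℓ ℓ).trans (dvd_mul_left _ N)
  have h3 : N * (ℓ * 1) ∣ N' := by rw [mul_one]; exact hℓ1
  rw [← iota_congr (mul_one ℓ) h3 hℓ1 v]
  exact heckeT_iota_mul h3 h1 hℓ hℓN' v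

omit [NeZero N] in
/-- `U_ℓ ι_{ℓ²} v = ι_ℓ v` at level `N' = Nℓ²`. [cite: DiamondShurman2005, Prop. 5.6.2 (proof, second diagram)] -/
theorem heckeT_iota_ellSq_goodLevel (hN' : N' = N * (ℓ * ℓ)) (hℓ : ℓ.Prime) (v : CuspForm (Gamma0 N) 2) :
    heckeT (Gamma0 N') 2 ℓ (iota N N' (ℓ * ℓ) 2 hℓ2 v) = iota N N' ℓ 2 hℓ1 v := by
  have hℓN' : ℓ ∣ N' := by rw [hN']; exact (dvd_mul_right ℓ ℓ).trans (dvd_mul_left _ N)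
  exact heckeT_iota_mul hℓ2 hℓ1 hℓ hℓN' v

/-- **`U_ℓ D v = 0`** for a `T_ℓ`-eigenvector `v ∈ S₂(Γ₀(N))` with eigenvalue `a` (`ℓ ∤ N`, `N' = Nℓ²`):
`U_ℓ(ι₁v − a ι_ℓ v + ℓ ι_{ℓ²} v) = (a ι₁v − ℓ ι_ℓ v) − a ι₁ v + ℓ ι_ℓ v = 0` — the Euler factor at `ℓ` is removed.
[cite: DiamondShurman2005, Prop. 5.6.2] [cite: GreenbergVatsal2000, §1 p. 9 (display (8))] -/
theorem heckeT_goodDeplete_self (hN' : N' = N * (ℓ * ℓ)) (hℓ : ℓ.Prime) (hℓN : ¬ ℓ ∣ N) {v : CuspForm (Gamma0 N) 2} {a : ℂ}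
    (hv : heckeT (Gamma0 N) 2 ℓ v = a • v) :
    heckeT (Gamma0 N') 2 ℓ (iota N N' 1 2 h1 v - a • iota N N' ℓ 2 hℓ1 v + (ℓ : ℂ) • iota N N' (ℓ * ℓ) 2 hℓ2 v) = 0 := by
  rw [map_add, map_sub, map_smul, map_smul, heckeT_iota_one_goodLevel h1 hℓ1 hN' hℓ hℓN, hv, map_smul,
    heckeT_iota_ell_goodLevel h1 hℓ1 hN' hℓ, heckeT_iota_ellSq_goodLevel hℓ1 hℓ2 hN' hℓ]
  module

variable {G : CuspForm (Gamma0 N) 2} (hGeig : IsHeckeEigenform G) (hGnorm : IsNormalized G)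
include hGeig hGnorm

/-- **The good-prime depletion `D G = ι₁ G − a_ℓ(G) ι_ℓ G + ℓ ι_{ℓ²} G` of a normalised eigenform is a Hecke eigenform at
level `Nℓ²`** (`ℓ ∤ N`): `T_p` for `p ≠ ℓ` by `heckeT_goodDeplete_of_ne`, `U_ℓ` with eigenvalue `0`.
[cite: DiamondShurman2005, Prop. 5.6.2 and §5.7] -/
theorem isHeckeEigenform_goodDeplete (hN' : N' = N * (ℓ * ℓ)) (hℓ : ℓ.Prime) (hℓN : ¬ ℓ ∣ N) :
    IsHeckeEigenform (iota N N' 1 2 h1 G - cuspCoeff G ℓ • iota N N' ℓ 2 hℓ1 G + (ℓ : ℂ) • iota N N' (ℓ * ℓ) 2 hℓ2 G) := by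
  intro p hp
  haveI : NeZero p := ⟨hp.ne_zero⟩
  by_cases hpℓ : p = ℓ
  · subst hpℓ
    refine ⟨0, ?_⟩
    have hv : heckeT (Gamma0 N) 2 p G = cuspCoeff G p • G := by
      rw [heckeT_eq_heckeEigenvalue_smul G p (hGeig p hp), heckeEigenvalue_eq_coeff_of_isNormalized hGnorm hp (hGeig p hp)]
      rfl
    rw [heckeT_goodDeplete_self h1 hℓ1 hℓ2 hN' hp hℓN hv, zero_smul]
  · obtain ⟨c, hc⟩ := hGeig p hp
    refine ⟨c, ?_⟩
    rw [heckeT_goodDeplete_of_ne h1 hℓ1 hℓ2 hN' hℓ hp hpℓ, hc, map_smul, map_smul, map_smul, smul_add, smul_sub,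
      smul_comm c (cuspCoeff G ℓ), smul_comm c (ℓ : ℂ)]

omit [NeZero N] [NeZero N'] hGeig in
/-- Prime coefficients of the good-prime depletion: `a_ℓ(D G) = 0`, `a_p(D G) = a_p(G)` for `p ≠ ℓ`.
[cite: DiamondShurman2005, §5.7 (ι_d on Fourier expansions)] -/
theorem cuspCoeff_goodDeplete_prime (hℓ : ℓ.Prime) {p : ℕ} (hp : p.Prime) :
    cuspCoeff (iota N N' 1 2 h1 G - cuspCoeff G ℓ • iota N N' ℓ 2 hℓ1 G + (ℓ : ℂ) • iota N N' (ℓ * ℓ) 2 hℓ2 G) p =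
      if p = ℓ then 0 else cuspCoeff G p := by
  rw [cuspCoeff_goodDeplete]
  by_cases hpℓ : p = ℓ
  · subst hpℓ
    have hsq : ¬ p * p ∣ p := fun h ↦ by
      have := Nat.le_of_dvd hp.pos h
      nlinarith [hp.one_lt]
    rw [if_pos dvd_rfl, Nat.div_self hp.pos, if_neg hsq, if_pos rfl, show cuspCoeff G 1 = 1 from hGnorm, mul_one,
      mul_zero, add_zero, sub_self]
  · have h1' : ¬ ℓ ∣ p := fun h ↦ hpℓ ((Nat.prime_dvd_prime_iff_eq hℓ hp).mp h).symm
    have h2' : ¬ ℓ * ℓ ∣ p := fun h ↦ h1' ((dvd_mul_right ℓ ℓ).trans h)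
    rw [if_neg h1', if_neg h2', if_neg hpℓ, mul_zero, mul_zero, sub_zero, add_zero]

/-- The Hecke eigenvalues of the good-prime depletion: `0` at `ℓ`, `a_p(G)` at `p ≠ ℓ`. [cite: DiamondShurman2005, §5.7] -/
theorem heckeEigenvalue_goodDeplete (hN' : N' = N * (ℓ * ℓ)) (hℓ : ℓ.Prime) (hℓN : ¬ ℓ ∣ N) {p : ℕ} (hp : p.Prime) :
    heckeEigenvalue (iota N N' 1 2 h1 G - cuspCoeff G ℓ • iota N N' ℓ 2 hℓ1 G + (ℓ : ℂ) • iota N N' (ℓ * ℓ) 2 hℓ2 G) p =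
      if p = ℓ then 0 else cuspCoeff G p := by
  rw [heckeEigenvalue_eq_coeff_of_isNormalized (isNormalized_goodDeplete h1 hℓ1 hℓ2 hGnorm hℓ _) hp
    (isHeckeEigenform_goodDeplete h1 hℓ1 hℓ2 hGeig hGnorm hN' hℓ hℓN p hp)]
  exact cuspCoeff_goodDeplete_prime h1 hℓ1 hℓ2 hGnorm hℓ hp

end Operators

end Summit.BirchSwinnertonDyer.BirchSwinnertonDyer.Theorems.SmallImageRttKan

end
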